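import Literature.MathematicalPhysics.QuantumFieldTheory.Balaban1983to89.Node00.OpsYSectDCoords
import Literature.MathematicalPhysics.QuantumFieldTheory.Balaban1983to89.B6RandomWalkHom

/-!
# `Balaban1983to89.Node00.OpsYNablaBridge` — «`D_U` IS `∇_U` READ ON BONDS»: [B9] (3.3)'s second form `(D_{U,μ}λ)(x) = (D_Uλ)(⟨x, x+ηe_μ⟩)` and p.391's
# identification `A(x, x+ηe_μ) = A_μ(x)` BY NAME at def-Y's letters (`gradY ∕ divY` of `OpsYDeltaA` §3 versus `cdS ∕ cdsS` of `OpsYOfLetters` §2), the exact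
# bridge between n06-d's site-carrier models `DcoS ∕ DscoS` (`B9CoReadingCoordsS`) and def-Y's pins `DvcoKH ∕ DvscoKH` (`OpsYSectDCoords` §5), and the
# transfer of (3.42)-shaped majorants across it

T. Bałaban, *Propagators for lattice gauge theories in a background field*, Commun. Math. Phys. **99** (1985) 389–434
[`Balaban1985BackgroundPropagators`, "B9"].  statement-level skeleton of published theorems with citation tags; proofs where landed; nothing here is a
claim about the Yang–Mills mass gap.

THE PRINTED LOCI.  (3.3) p.390–391: *«(D_Uλ)(⟨x, x+ηe_μ⟩) = η⁻¹(R(U(x, x+ηe_μ))λ(x+ηe_μ) − λ(x)) = (D_{U,μ}λ)(x)»*; p.391: *«we identify a function A on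
bonds with the vector function A_μ(x) = A(x, x+ηe_μ)»*; (3.8) p.392 (`D*_U` the adjoint); (3.23) p.394 (`Δ_U = D*_UD_U`); Thm 3.1 (3.42) p.397 (`|(∇_UG′(U)λ)(x)| ≤ …, supp λ ⊂ Δ(y′)`), (3.43) ∕ (3.46)
p.398 (the `G′(U)∇*_U` forms).

THE POINT.  def-Y carries TWO typings of the covariant derivative of the site sector: the BOND-valued letter `gradY i U : (sites → 𝔸) →ₗ (bonds → 𝔸)`
(physical units `c_f`, `OpsYDeltaA` §3; its model at n06-d's pins is `OpsYSectDCoords.DvcoKH = coordOpKH b (fun _ => gradY)`, slot PASSIVE) and the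
DIRECTION-indexed site letters `cdS i U μ : (sites → 𝔸) → (sites → 𝔸)` (lattice units, `OpsYOfLetters` §2; their model is `B9CoReadingCoordsS.DcoS =
η⁻¹ • coordOpK b (fun ν => cdSL ν)`, slot = the DERIVATIVE DIRECTION).  They are the same object read two ways; this file proves it and moves majorants across.
* §1 torus bookkeeping: `chartY` (NODE 00's box chart `boxEquiv i.hN` with codomain typed `SiteY i`; `chartY_eq` is `rfl`), `sum_bond_eq`, `shift_ne_self ∕
  tgt_ne_src ∕ unshift_ne_self` (the torus has ≥ 2 sites per direction), `unshift_shift ∕ shift_unshift ∕ shift_eq_iff`, ★ `shiftY_chartY ∕ shiftY_symm_chartY`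
  (the chart intertwines `Site.shift` with def-Y's `shiftY`), `gradK_apply_of_ne ∕ gradK_apply_tgt ∕ gradK_apply_src ∕ divK_apply` (the flat kernels on the
  stencil), `gradT_apply_tgt ∕ gradT_apply_src` (the transporters on the stencil), `cdS_apply ∕ cdsS_apply`;
* §2 THE LETTER IDENTITIES: def `bondCompY μ` (print's `A_μ(x) := A(x, x+ηe_μ)` on the chart), ★★ `gradY_apply_eq_cdS` (`(D_Uλ)(b) = c_f·(∇_{U,b.dir}λ)(b₋)`),
  ★★ `bondCompY_gradY ∕ bondCompY_comp_gradY` ((3.3)₂ literally: `(D_Uλ)_μ = c_f·∇_{U,μ}λ`), ★★ `divY_apply_eq_sum_cdsS ∕ divY_eq_sum_cdsSL_comp`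
  (`D*_UA = c_f·Σ_μ ∇*_{U,μ}A_μ`, (3.8)), `divY_gradY_apply` (`D*_UD_U = c_f²·Σ_μ∇*_μ∇_μ = c_f²·lapS`, (3.23) p.394);
* §3 THE CARRIER BRIDGE at n06-d's pins: defs `slotCopyK ν`, `dirSliceK μ ν` (+ `_apply`), `coordOpK_apply4 ∕ coordOpKH_apply4`, `assembleK_slotCopyK ∕
  coordOpK_const_slotCopyK ∕ assembleK_dirSliceK ∕ slotCopyK_GcoS`, ★★ `DvcoKH_apply_eq` (`DvcoKH f (b, ν, c, c′) = (c_f·η)·DcoS (slotCopyK ν f) (chart b₋, b.dir, c, c′)`),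
  ★★ `DvcoKH_GcoS_apply_eq` (the same for the e1-composites `DvcoKH ∘ GcoS T` vs `DcoS ∘ GcoS T`), ★★ `DvscoKH_apply_eq_sum` (`DvscoKH A (z, ν, c, c′) =
  (c_f·η)·Σ_μ DscoS (dirSliceK μ ν A) (z, μ, c, c′)`), ★★ `GcoS_DvscoKH_apply_eq_sum` (the e2-composites); the scalar `c_f·η` (`cf_mul_etaS_of_hcfk ∕
  abs_cf_mul_etaS_of_hcfk`: `= 1` in print's units `c_f = L^k`, i.e. at every `MemberY` by `MemberY.hcfk` ∕ n06-i's `B9Ineq349SiteFromBlocks.etaS_eq_abs_cf_inv`);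
* §4 MAJORANT TRANSFER (generic geometry `g`, generic kernels; `B6RandomWalkHom.HasMajorantHom`): `blockSupp_slotCopyK ∕ blockSupp_dirSliceK ∕ slotBlind_of_compat`,
  `compat_blkSK_blkBK` (n06-d's `blkSK (sIK bI)` ∕ `blkBK bI` are COMPATIBLE when `bI` is direction-blind), ★★ `hasMajorantHom_DvcoKH_GcoS` (an e1-majorant of
  `DcoS ∘ GcoS T` on a slot-blind site block map gives one of `DvcoKH ∘ GcoS T` under a one-line kernel domination), ★★ `hasMajorantHom_DvcoKH_GcoS_of_compat` ∕
  ★★ `hasMajorantHom_GcoS_DvscoKH_of_compat` (explicit kernels `(|c_f|η)·K`, `((d+1)|c_f|η)·K` for compatible block maps).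
CONSUMERS.  dag-n06-d's next edition (ASK-3 Q1, bus 2026-08-28: its displayed `h31 : Thm31GpMaj … (DvcoKH …) (DvscoKH …)` is, through §3–§4, a statement about
n06-i's `B9Ineq349SiteFromPinsPairM.majorants342_of_t37_pairM` faces on `DcoS ∘ GcoS`, `GcoS ∘ DscoS` — derivable or displayed, either way through these names);
dag-n06-l's per-letter schemas (`B9PerturbationMajorantsAtLettersPhys`).
HONEST SCOPE.  Finite sums and linear algebra over def-Y's letters and n06-d's functor calculus; nothing of [B9]'s estimates asserted and no majorant PRODUCED
(§4 only transfers one); count-neutral; N06 NOT discharged; O5 (`hIds3124`) untouched; one finite lattice programme at fixed ε; nothing continuum ∕ ℝ⁴ ∕ OS ∕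
mass gap ∕ Clay.  Cell `pub-ymgap` (D-0062), node N06 [B9] at NODE 00's instance, seat `pub-ymgap-node00-def-Y` (g18), 2026-08-28.
-/

noncomputable section

open scoped BigOperators

namespace Literature.MathematicalPhysics.QuantumFieldTheory.Balaban1983to89.Node00.OpsYNablaBridge

open LatticeFieldCalculus (shiftEquiv)
open B6Ineq2133TwoScaleV1 (onFun)
open B6SectAOperatorsV1 (dE)
open B6AgreeLapV1Chart (toMatrix'_dE)
open B6GlobalChartV1 (PV boxEquiv toBox)
open B6ScalarChartV1 (toBox_shift)
open B6KLevelCensusIndexV1 (KIdx)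
open B6Prop22KLevelTorusCensusEta (nKT)
open B6RandomWalk (BlockSupp)
open B6RandomWalkHom (HasMajorantHom)
open B9Eq39Adjoint (R R_one)
open B9Thm39ReadingCoords (cR39)
open B9Ineq349SiteComposite (cdSL cdsSL cdSL_apply cdsSL_apply etaS_pos)
open B9CoReadingCoords (assembleK assembleK_smul coordOpK assembleK_coordOpK XBK blkBK)
open B9CoReadingCoordsH (coordOpKH assembleK_coordOpKH)
open B9CoReadingCoordsS (XSK blkSK sIK GcoS DcoS DscoS)
open Node00 (SiteY FBondY IBondY CfgY SiteOpY toKT shiftY cdS cdsS lapS etaS trLiftY_apply gradK divK gradT gradY divY divK_eq_transpose)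
open Node00.OpsYSectDCoords (DvcoKH DvscoKH)

variable {d ℓ : ℕ} {hd : 1 ≤ d + 1} {hL : Odd (ℓ + 1) ∧ 1 < ℓ + 1} {b₀ b₁ : ℝ}
variable {𝔸 : Type} [NormedRing 𝔸] [NormedAlgebra ℂ 𝔸] [CompleteSpace 𝔸]
variable (i : KIdx d ℓ hd hL b₀ b₁)

/-! ## §1 Torus bookkeeping: the chart typed at `SiteY`, sums over bonds, `b₊ ≠ b₋`, the shifts, the flat kernels and transporters on the stencil -/

section Torus

/-- NODE 00's box chart `boxEquiv i.hN` with its codomain TYPED as def-Y's `SiteY i` (the same function; the retyping makes the instances of `SiteY i` elaborate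
uniformly in the identities below; `chartY i = boxEquiv i.hN` is `rfl`). [cite: Balaban1984PropagatorsII, (2.1) p.224, dictionary (`B6GlobalChartV1.boxEquiv`)] -/
abbrev chartY : Site (PV d ℓ i.m i.K hd hL) 0 ≃ SiteY i := boxEquiv i.hN

omit [CompleteSpace 𝔸] in
/-- the retyped chart IS the chart. [cite: Balaban1984PropagatorsII, (2.1) p.224, bookkeeping] -/
theorem chartY_eq : (chartY i : Site (PV d ℓ i.m i.K hd hL) 0 ≃ SiteY i) = boxEquiv i.hN := rfl

/-- a sum over positively oriented bonds is a double sum over initial points and directions. [folklore] [cite: Balaban1985BackgroundPropagators, p.391 («A_μ(x) = A(x, x+ηe_μ)»), bookkeeping] -/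
theorem sum_bond_eq {α : Type} [AddCommMonoid α] (F : FBondY i → α) :
    ∑ b : FBondY i, F b = ∑ x : Site (PV d ℓ i.m i.K hd hL) 0, ∑ μ : Fin (d + 1), F ⟨x, μ⟩ := by
  rw [← Fintype.sum_prod_type' (f := fun x μ => F ⟨x, μ⟩)]
  exact Fintype.sum_equiv ⟨fun b => (b.src, b.dir), fun p => ⟨p.1, p.2⟩, fun _ => rfl, fun _ => rfl⟩ _ _ fun _ => rfl

/-- the torus of record has at least two sites per direction, so `x + e_μ ≠ x`. [folklore] [cite: Balaban1984PropagatorsII, (2.1) p.224, bookkeeping] -/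
theorem shift_ne_self (x : Site (PV d ℓ i.m i.K hd hL) 0) (μ : Fin (d + 1)) : x.shift μ ≠ x := by
  intro h
  have h1 : x μ + 1 = x μ := by
    have h2 := congrFun h μ
    simp only [Site.shift, Function.update_self] at h2
    exact h2
  have hlt : 1 < (PV d ℓ i.m i.K hd hL).sitesPerDir 0 := by
    unfold Params.sitesPerDir
    have : 0 < (PV d ℓ i.m i.K hd hL).L ^ ((PV d ℓ i.m i.K hd hL).m + (PV d ℓ i.m i.K hd hL).K - 0) := Nat.pow_pos (Nat.succ_pos ℓ)
    omega
  haveI : Fact (1 < (PV d ℓ i.m i.K hd hL).sitesPerDir 0) := ⟨hlt⟩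
  exact one_ne_zero (add_eq_left.1 h1)

/-- `b₊ ≠ b₋`. [folklore] [cite: Balaban1985BackgroundPropagators, (3.3) p.390, bookkeeping] -/
theorem tgt_ne_src (b : FBondY i) : b.tgt ≠ b.src := shift_ne_self i b.src b.dir

/-- `(x + e_μ) − e_μ = x`. [folklore] [cite: Balaban1985BackgroundPropagators, (3.8) p.392, bookkeeping] -/
theorem unshift_shift (x : Site (PV d ℓ i.m i.K hd hL) 0) (μ : Fin (d + 1)) : (x.shift μ).unshift μ = x :=
  (shiftEquiv (P := PV d ℓ i.m i.K hd hL) (j := 0) μ).symm_apply_apply x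

/-- `(x − e_μ) + e_μ = x`. [folklore] [cite: Balaban1985BackgroundPropagators, (3.8) p.392, bookkeeping] -/
theorem shift_unshift (x : Site (PV d ℓ i.m i.K hd hL) 0) (μ : Fin (d + 1)) : (x.unshift μ).shift μ = x :=
  (shiftEquiv (P := PV d ℓ i.m i.K hd hL) (j := 0) μ).apply_symm_apply x

/-- `x − e_μ ≠ x`. [folklore] [cite: Balaban1985BackgroundPropagators, (3.8) p.392, bookkeeping] -/
theorem unshift_ne_self (x : Site (PV d ℓ i.m i.K hd hL) 0) (μ : Fin (d + 1)) : x.unshift μ ≠ x := fun h =>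
  shift_ne_self i (x.unshift μ) μ ((shift_unshift i x μ).trans h.symm)

/-- `x + e_μ = w ↔ x = w − e_μ`. [folklore] [cite: Balaban1985BackgroundPropagators, (3.8) p.392, bookkeeping] -/
theorem shift_eq_iff (x w : Site (PV d ℓ i.m i.K hd hL) 0) (μ : Fin (d + 1)) : x.shift μ = w ↔ x = w.unshift μ :=
  ⟨fun h => h ▸ (unshift_shift i x μ).symm, fun h => h ▸ shift_unshift i w μ⟩

/-- ★ the chart intertwines the torus translation with def-Y's `shiftY`: `shiftY μ (chart x) = chart (x + e_μ)`. [cite: Balaban1985BackgroundPropagators, (3.3) p.390, dictionary (`B6ScalarChartV1.toBox_shift`)] -/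
theorem shiftY_chartY (μ : Fin (d + 1)) (x : Site (PV d ℓ i.m i.K hd hL) 0) : shiftY i μ (chartY i x) = chartY i (x.shift μ) := by
  show shiftY i μ (toBox i.hN x) = toBox i.hN (x.shift μ)
  rw [toBox_shift]
  rfl

/-- `shiftY μ⁻¹ (chart x) = chart (x − e_μ)`. [cite: Balaban1985BackgroundPropagators, (3.8) p.392, dictionary] -/
theorem shiftY_symm_chartY (μ : Fin (d + 1)) (x : Site (PV d ℓ i.m i.K hd hL) 0) : (shiftY i μ).symm (chartY i x) = chartY i (x.unshift μ) := by
  rw [Equiv.symm_apply_eq, shiftY_chartY, shift_unshift]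

/-- the gradient kernel off the stencil: `∂(b, z) = 0` unless `z ∈ {chart b₊, chart b₋}`. [cite: Balaban1985BackgroundPropagators, (3.3) p.390; Balaban1984PropagatorsI, (1.4) p.18, bookkeeping] -/
theorem gradK_apply_of_ne {b : FBondY i} {z : SiteY i} (h1 : z ≠ chartY i b.tgt) (h0 : z ≠ chartY i b.src) : gradK i b z = 0 := by
  change LinearMap.toMatrix' (onFun (dE (P := PV d ℓ i.m i.K hd hL) i.cf)) b ((boxEquiv i.hN).symm z) = 0
  have h1' : ¬ b.tgt = (boxEquiv i.hN).symm z := fun h => h1 ((Equiv.eq_symm_apply _).1 h).symm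
  have h0' : ¬ b.src = (boxEquiv i.hN).symm z := fun h => h0 ((Equiv.eq_symm_apply _).1 h).symm
  rw [toMatrix'_dE, if_neg h1', if_neg h0', sub_zero, mul_zero]

/-- the gradient kernel at the final point: `∂(b, chart b₊) = c_f`. [cite: Balaban1985BackgroundPropagators, (3.3) p.390, bookkeeping] -/
theorem gradK_apply_tgt (b : FBondY i) : gradK i b (chartY i b.tgt) = i.cf := by
  change LinearMap.toMatrix' (onFun (dE (P := PV d ℓ i.m i.K hd hL) i.cf)) b ((boxEquiv i.hN).symm (boxEquiv i.hN b.tgt)) = i.cf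
  rw [Equiv.symm_apply_apply, toMatrix'_dE, if_pos rfl, if_neg (fun h => tgt_ne_src i b h.symm), sub_zero, mul_one]

/-- the gradient kernel at the initial point: `∂(b, chart b₋) = −c_f`. [cite: Balaban1985BackgroundPropagators, (3.3) p.390, bookkeeping] -/
theorem gradK_apply_src (b : FBondY i) : gradK i b (chartY i b.src) = -i.cf := by
  change LinearMap.toMatrix' (onFun (dE (P := PV d ℓ i.m i.K hd hL) i.cf)) b ((boxEquiv i.hN).symm (boxEquiv i.hN b.src)) = -i.cf
  rw [Equiv.symm_apply_apply, toMatrix'_dE, if_neg (tgt_ne_src i b), if_pos rfl, zero_sub, mul_neg_one]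

/-- the divergence kernel is the transposed gradient kernel, entrywise. [cite: Balaban1985BackgroundPropagators, (3.8) p.392, bookkeeping] -/
theorem divK_apply (z : SiteY i) (b : FBondY i) : divK i z b = gradK i b z := by
  rw [divK_eq_transpose]; rfl

/-- the gradient transporter on the forward leg: `T(b, chart b₊) = U(b)`. [cite: Balaban1985BackgroundPropagators, (3.3) p.390, bookkeeping] -/
theorem gradT_apply_tgt (U : CfgY 𝔸 i) (b : FBondY i) : gradT i U b (chartY i b.tgt) = U b.dir b.src := by
  unfold gradT
  split_ifs with h
  · rfl
  · exact absurd rfl h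

/-- the gradient transporter on the initial leg: `T(b, chart b₋) = 1`. [cite: Balaban1985BackgroundPropagators, (3.3) p.390, bookkeeping] -/
theorem gradT_apply_src (U : CfgY 𝔸 i) (b : FBondY i) : gradT i U b (chartY i b.src) = 1 := by
  unfold gradT
  split_ifs with h
  · exact absurd ((boxEquiv i.hN).injective h).symm (tgt_ne_src i b)
  · rfl

/-- `cdS`, unfolded: `(∇_{U,μ}Φ)(z) = R(U_μ(chart⁻¹ z))Φ(shiftY μ z) − Φ(z)`. [cite: Balaban1985BackgroundPropagators, (3.3) p.390, bookkeeping] -/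
theorem cdS_apply (U : CfgY 𝔸 i) (μ : Fin (d + 1)) (Φ : SiteY i → 𝔸) (z : SiteY i) :
    cdS i U μ Φ z = R (U μ ((chartY i).symm z)) (Φ (shiftY i μ z)) - Φ z := rfl

/-- `cdsS`, unfolded: `(∇*_{U,μ}Φ)(z) = R(U_μ(chart⁻¹(shiftY μ⁻¹ z))⁻¹)Φ(shiftY μ⁻¹ z) − Φ(z)`. [cite: Balaban1985BackgroundPropagators, (3.8) p.392, bookkeeping] -/
theorem cdsS_apply (U : CfgY 𝔸 i) (μ : Fin (d + 1)) (Φ : SiteY i → 𝔸) (z : SiteY i) :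
    cdsS i U μ Φ z = R (U μ ((chartY i).symm ((shiftY i μ).symm z)))⁻¹ (Φ ((shiftY i μ).symm z)) - Φ z := rfl

end Torus

/-! ## §2 The letter identities: `D_U` versus `∇_{U,μ}` (3.3), `D*_U` versus `∇*_{U,μ}` (3.8), `D*_UD_U` versus `Σ_μ∇*_μ∇_μ` (3.23) -/

section Letters

/-- **print's identification `A_μ(x) := A(x, x+ηe_μ)` on the box chart**: the `μ`-components of a bond function as a site function. [cite: Balaban1985BackgroundPropagators, p.391 («we identify a function A on bonds with the vector function A_μ(x)»)] -/
def bondCompY (μ : Fin (d + 1)) : (FBondY i → 𝔸) →ₗ[ℂ] (SiteY i → 𝔸) where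
  toFun A := fun w => A ⟨(chartY i).symm w, μ⟩
  map_add' _ _ := rfl
  map_smul' _ _ := rfl

omit [CompleteSpace 𝔸] in
/-- `bondCompY`, evaluated. [cite: Balaban1985BackgroundPropagators, p.391, bookkeeping] -/
@[simp] theorem bondCompY_apply (μ : Fin (d + 1)) (A : FBondY i → 𝔸) (w : SiteY i) :
    bondCompY (𝔸 := 𝔸) i μ A w = A ⟨(chartY i).symm w, μ⟩ := rfl

/-- ★★ **(3.3): `(D_Uλ)(b) = c_f·(∇_{U,b.dir}λ)(chart b₋)`** — def-Y's bond-valued covariant gradient IS its direction-indexed site derivative read at the initial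
point, up to the units (`gradY` physical `c_f`, `cdS` lattice). [cite: Balaban1985BackgroundPropagators, (3.3) p.390–391 («= (D_{U,μ}λ)(x)»)] -/
theorem gradY_apply_eq_cdS (U : CfgY 𝔸 i) (Φ : SiteY i → 𝔸) (b : FBondY i) :
    gradY i U Φ b = ((i.cf : ℝ) : ℂ) • cdS i U b.dir Φ (chartY i b.src) := by
  have hne : chartY i b.tgt ≠ chartY i b.src := fun h => tgt_ne_src i b ((chartY i).injective h)
  rw [gradY, trLiftY_apply, Fintype.sum_eq_add (chartY i b.tgt) (chartY i b.src) hne fun z hz => by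
    rw [gradK_apply_of_ne i hz.1 hz.2, Complex.ofReal_zero, zero_smul]]
  rw [gradK_apply_tgt, gradK_apply_src, gradT_apply_tgt, gradT_apply_src, R_one, cdS_apply, Equiv.symm_apply_apply, shiftY_chartY,
    Complex.ofReal_neg, neg_smul, ← sub_eq_add_neg, ← smul_sub]
  rfl

/-- ★★ **(3.3)₂ literally: `(D_Uλ)_μ = c_f·∇_{U,μ}λ`** — the `μ`-components of `D_Uλ` ARE the site derivatives. [cite: Balaban1985BackgroundPropagators, (3.3) p.390–391 («(D_{U,μ}λ)(x) = (D_Uλ)(⟨x, x+ηe_μ⟩)»)] -/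
theorem bondCompY_gradY (U : CfgY 𝔸 i) (μ : Fin (d + 1)) (Φ : SiteY i → 𝔸) :
    bondCompY i μ (gradY i U Φ) = ((i.cf : ℝ) : ℂ) • cdS i U μ Φ := by
  funext w
  rw [bondCompY_apply, gradY_apply_eq_cdS, Pi.smul_apply, Equiv.apply_symm_apply]

/-- the operator form: `(·)_μ ∘ D_U = c_f • ∇_{U,μ}`. [cite: Balaban1985BackgroundPropagators, (3.3) p.390–391] -/
theorem bondCompY_comp_gradY (U : CfgY 𝔸 i) (μ : Fin (d + 1)) :
    bondCompY i μ ∘ₗ gradY i U = ((i.cf : ℝ) : ℂ) • cdSL i U μ := by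
  apply LinearMap.ext; intro Φ
  rw [LinearMap.comp_apply, bondCompY_gradY, LinearMap.smul_apply, cdSL_apply]

/-- ★★ **(3.8): `(D*_UA)(z) = c_f·Σ_μ (∇*_{U,μ}A_μ)(z)`** — def-Y's covariant divergence IS the sum of its direction-indexed adjoint site derivatives of the
components. [cite: Balaban1985BackgroundPropagators, (3.8) p.392 (D*_U the adjoint of D_U), p.391 («A_μ(x) = A(x, x+ηe_μ)»)] -/
theorem divY_apply_eq_sum_cdsS (U : CfgY 𝔸 i) (A : FBondY i → 𝔸) (z : SiteY i) :
    divY i U A z = ((i.cf : ℝ) : ℂ) • ∑ μ : Fin (d + 1), cdsS i U μ (bondCompY i μ A) z := by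
  obtain ⟨w, rfl⟩ := (chartY i).surjective z
  -- per direction `μ`, only the bonds `⟨w − e_μ, μ⟩` (final point `w`, transporter `U(b)⁻¹`) and `⟨w, μ⟩` (initial point `w`, transporter `1`) contribute
  have ht : ∀ μ : Fin (d + 1), gradK i ⟨w.unshift μ, μ⟩ (chartY i w) = i.cf ∧ gradT i U ⟨w.unshift μ, μ⟩ (chartY i w) = U μ (w.unshift μ) := by
    intro μ
    have e1 : chartY i w = chartY i (PBond.tgt (⟨w.unshift μ, μ⟩ : FBondY i)) := congrArg _ (shift_unshift i w μ).symm
    rw [e1]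
    exact ⟨gradK_apply_tgt i _, gradT_apply_tgt i U _⟩
  have hμ : ∀ μ : Fin (d + 1), ∑ x : Site (PV d ℓ i.m i.K hd hL) 0, (((gradK i ⟨x, μ⟩ (chartY i w) : ℝ)) : ℂ) • R (gradT i U ⟨x, μ⟩ (chartY i w))⁻¹ (A ⟨x, μ⟩) =
      ((i.cf : ℝ) : ℂ) • cdsS i U μ (bondCompY i μ A) (chartY i w) := by
    intro μ
    rw [Fintype.sum_eq_add (w.unshift μ) w (unshift_ne_self i w μ) fun x hx => by
      rw [gradK_apply_of_ne i (b := ⟨x, μ⟩) (z := chartY i w) (fun h => hx.1 ((shift_eq_iff i x w μ).1 ((chartY i).injective h).symm))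
        (fun h => hx.2 ((chartY i).injective h).symm), Complex.ofReal_zero, zero_smul]]
    rw [(ht μ).1, (ht μ).2, show chartY i w = chartY i (PBond.src (⟨w, μ⟩ : FBondY i)) from rfl, gradK_apply_src, gradT_apply_src, inv_one, R_one,
      Complex.ofReal_neg, neg_smul, ← sub_eq_add_neg, ← smul_sub, cdsS_apply]
    show _ = ((i.cf : ℝ) : ℂ) • (R (U μ ((chartY i).symm ((shiftY i μ).symm (chartY i w))))⁻¹ (A ⟨(chartY i).symm ((shiftY i μ).symm (chartY i w)), μ⟩) -
      A ⟨(chartY i).symm (chartY i w), μ⟩)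
    rw [shiftY_symm_chartY, Equiv.symm_apply_apply, Equiv.symm_apply_apply]
  rw [divY, trLiftY_apply]
  simp_rw [divK_apply]
  rw [sum_bond_eq, Finset.sum_comm, Finset.smul_sum]
  exact Finset.sum_congr rfl fun μ _ => hμ μ

/-- the operator form: `D*_U = c_f • Σ_μ ∇*_{U,μ} ∘ (·)_μ`. [cite: Balaban1985BackgroundPropagators, (3.8) p.392] -/
theorem divY_eq_sum_cdsSL_comp (U : CfgY 𝔸 i) :
    divY i U = ((i.cf : ℝ) : ℂ) • ∑ μ : Fin (d + 1), cdsSL i U μ ∘ₗ bondCompY i μ := by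
  apply LinearMap.ext; intro A; funext z
  rw [divY_apply_eq_sum_cdsS, LinearMap.smul_apply, Pi.smul_apply, LinearMap.coe_sum, Finset.sum_apply, Finset.sum_apply]
  rfl

/-- **(3.23): `D*_UD_U = c_f²·Σ_μ ∇*_{U,μ}∇_{U,μ}`** — def-Y's `divY ∘ gradY` IS `c_f²` times its lattice-unit covariant Laplacian `lapS` (the letter behind n06-d's
`LcoS`, prefactor `η⁻² = c_f²` in print's units). [cite: Balaban1985BackgroundPropagators, (3.23) p.394, (3.6) p.391] -/
theorem divY_gradY_apply (U : CfgY 𝔸 i) (Φ : SiteY i → 𝔸) (z : SiteY i) :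
    divY i U (gradY i U Φ) z = ((i.cf ^ 2 : ℝ) : ℂ) • lapS i U Φ z := by
  rw [divY_apply_eq_sum_cdsS]
  simp_rw [bondCompY_gradY, ← cdsSL_apply, map_smul, cdsSL_apply, Pi.smul_apply]
  rw [← Finset.smul_sum, smul_smul, ← Complex.ofReal_mul, ← pow_two]
  rfl

end Letters

/-! ## §3 The carrier bridge at n06-d's pins: `DvcoKH` versus `DcoS`, `DvscoKH` versus `DscoS`, singly and inside the (3.42) composites -/

section Carriers

variable {κ : Type}

/-- copy the `ν`-slice of a coordinate vector to every direction slot: `(slotCopyK ν f)(z, μ, a, c) := f(z, ν, a, c)`. [cite: Balaban1985BackgroundPropagators, (3.42) p.397, dictionary] -/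
def slotCopyK {S D : Type} (ν : D) : (S × D × κ × κ → ℝ) →ₗ[ℝ] (S × D × κ × κ → ℝ) where
  toFun f := fun p => f (p.1, ν, p.2.2)
  map_add' _ _ := rfl
  map_smul' _ _ := rfl

/-- `slotCopyK`, evaluated. [cite: Balaban1985BackgroundPropagators, (3.42) p.397, bookkeeping] -/
@[simp] theorem slotCopyK_apply {S D : Type} (ν : D) (f : S × D × κ × κ → ℝ) (z : S) (μ : D) (a c : κ) :
    slotCopyK ν f (z, μ, a, c) = f (z, ν, a, c) := rfl

/-- the `μ`-COMPONENTS of the `ν`-slice of a bond-carrier vector, as a site-carrier vector (every slot): `(dirSliceK μ ν A)(w, ·, a, c) := A(⟨chart⁻¹ w, μ⟩, ν, a, c)`.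
[cite: Balaban1985BackgroundPropagators, p.391 («A_μ(x) = A(x, x+ηe_μ)»), dictionary] -/
def dirSliceK (μ ν : Fin (d + 1)) : (XBK κ i → ℝ) →ₗ[ℝ] (XSK κ i → ℝ) where
  toFun A := fun p => A (⟨(chartY i).symm p.1, μ⟩, ν, p.2.2)
  map_add' _ _ := rfl
  map_smul' _ _ := rfl

/-- `dirSliceK`, evaluated. [cite: Balaban1985BackgroundPropagators, p.391, bookkeeping] -/
@[simp] theorem dirSliceK_apply (μ ν : Fin (d + 1)) (A : XBK κ i → ℝ) (w : SiteY i) (μ' : Fin (d + 1)) (a c : κ) :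
    dirSliceK i μ ν A (w, μ', a, c) = A (⟨(chartY i).symm w, μ⟩, ν, a, c) := rfl

variable [Fintype κ] (b : Module.Basis κ ℝ 𝔸)

omit [CompleteSpace 𝔸] in
/-- `coordOpK` on a 4-tuple. [cite: Balaban1985BackgroundPropagators, (3.42) p.397, bookkeeping] -/
theorem coordOpK_apply4 {S D : Type} (T : D → (S → 𝔸) →ₗ[ℝ] (S → 𝔸)) (f : S × D × κ × κ → ℝ) (z : S) (ν : D) (c c' : κ) :
    coordOpK b T f (z, ν, c, c') = b.repr (T ν (assembleK b ν c' f) z) c := rfl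

omit [CompleteSpace 𝔸] in
/-- `coordOpKH` on a 4-tuple. [cite: Balaban1985BackgroundPropagators, (3.126) p.420, bookkeeping] -/
theorem coordOpKH_apply4 {S S' D : Type} (T : D → (S' → 𝔸) →ₗ[ℝ] (S → 𝔸)) (f : S' × D × κ × κ → ℝ) (x : S) (ν : D) (c c' : κ) :
    coordOpKH b T f (x, ν, c, c') = b.repr (T ν (assembleK b ν c' f) x) c := rfl

omit [CompleteSpace 𝔸] in
/-- every slice of `slotCopyK ν f` assembles to the `ν`-slice of `f`. [cite: Balaban1985BackgroundPropagators, (3.42) p.397, bookkeeping] -/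
theorem assembleK_slotCopyK {S D : Type} (μ ν : D) (c' : κ) (f : S × D × κ × κ → ℝ) : assembleK b μ c' (slotCopyK ν f) = assembleK b ν c' f := rfl

omit [CompleteSpace 𝔸] in
/-- the model of a CONSTANT family commutes with `slotCopyK`. [cite: Balaban1985BackgroundPropagators, (3.42) p.397, bookkeeping] -/
theorem coordOpK_const_slotCopyK {S D : Type} (A : Module.End ℝ (S → 𝔸)) (ν : D) (f : S × D × κ × κ → ℝ) :
    coordOpK b (fun _ : D => A) (slotCopyK ν f) = slotCopyK ν (coordOpK b (fun _ : D => A) f) := rfl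

omit [CompleteSpace 𝔸] in
/-- every slice of `dirSliceK μ ν A` assembles to the `μ`-components of the assembled `ν`-slice of `A`. [cite: Balaban1985BackgroundPropagators, p.391, bookkeeping] -/
theorem assembleK_dirSliceK (μ ν μ' : Fin (d + 1)) (c' : κ) (A : XBK κ i → ℝ) :
    assembleK b μ' c' (dirSliceK i μ ν A) = bondCompY i μ (assembleK b ν c' A) := rfl

variable [FiniteDimensional ℝ 𝔸] (B : B9.Backgrounds) (cfg : B.Cfg → CfgY 𝔸 i) (O : SiteOpY 𝔸 i)

/-- `GcoS` (a scalar multiple of the model of a constant family) commutes with `slotCopyK`. [cite: Balaban1985BackgroundPropagators, (3.42) p.397, bookkeeping] -/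
theorem slotCopyK_GcoS (U₁ : B.Cfg) (ν : Fin (d + 1)) (f : XSK κ i → ℝ) :
    slotCopyK ν (GcoS i b B cfg O U₁ f) = GcoS i b B cfg O U₁ (slotCopyK ν f) := by
  rw [GcoS, LinearMap.smul_apply, LinearMap.smul_apply, map_smul, coordOpK_const_slotCopyK]

omit [FiniteDimensional ℝ 𝔸] in
/-- ★★ **THE BRIDGE, `D_U`**: def-Y's pin `DvcoKH` (slot passive, derivative direction = the bond's) IS n06-d's `DcoS` (slot = derivative direction) read at
`(chart b₋, b.dir)` on the slot-copied vector, up to the scalar `c_f·η`. [cite: Balaban1985BackgroundPropagators, (3.3) p.390–391, (3.42) p.397] -/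
theorem DvcoKH_apply_eq (U₁ : B.Cfg) (f : XSK κ i → ℝ) (x : FBondY i) (ν : Fin (d + 1)) (c c' : κ) :
    DvcoKH i b B cfg U₁ f (x, ν, c, c') = (i.cf * etaS i) * DcoS i b B cfg U₁ (slotCopyK ν f) (chartY i x.src, x.dir, c, c') := by
  rw [DvcoKH, coordOpKH_apply4, LinearMap.restrictScalars_apply, gradY_apply_eq_cdS, Complex.coe_smul, map_smul, Finsupp.smul_apply, smul_eq_mul,
    DcoS, LinearMap.smul_apply, Pi.smul_apply, smul_eq_mul, coordOpK_apply4, LinearMap.restrictScalars_apply, cdSL_apply, assembleK_slotCopyK,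
    mul_assoc, mul_inv_cancel_left₀ (etaS_pos i).ne']

/-- ★★ the same inside the first (3.42) composite: `(DvcoKH ∘ GcoS T) f (b, ν, c, c′) = (c_f·η)·(DcoS ∘ GcoS T)(slotCopyK ν f)(chart b₋, b.dir, c, c′)`.
[cite: Balaban1985BackgroundPropagators, Thm 3.1 (3.42) p.397 («∇_UG′(U)»)] -/
theorem DvcoKH_GcoS_apply_eq (U₁ : B.Cfg) (f : XSK κ i → ℝ) (x : FBondY i) (ν : Fin (d + 1)) (c c' : κ) :
    (DvcoKH i b B cfg U₁ ∘ₗ GcoS i b B cfg O U₁) f (x, ν, c, c') =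
      (i.cf * etaS i) * (DcoS i b B cfg U₁ ∘ₗ GcoS i b B cfg O U₁) (slotCopyK ν f) (chartY i x.src, x.dir, c, c') := by
  rw [LinearMap.comp_apply, LinearMap.comp_apply, DvcoKH_apply_eq, slotCopyK_GcoS]

omit [FiniteDimensional ℝ 𝔸] in
/-- ★★ **THE BRIDGE, `D*_U`**: def-Y's pin `DvscoKH` IS the direction-sum of n06-d's `DscoS` on the direction slices, up to `c_f·η`:
`DvscoKH A (z, ν, c, c′) = (c_f·η)·Σ_μ DscoS (dirSliceK μ ν A) (z, μ, c, c′)`. [cite: Balaban1985BackgroundPropagators, (3.8) p.392, (3.42) p.397] -/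
theorem DvscoKH_apply_eq_sum (U₁ : B.Cfg) (A : XBK κ i → ℝ) (z : SiteY i) (ν : Fin (d + 1)) (c c' : κ) :
    DvscoKH i b B cfg U₁ A (z, ν, c, c') = (i.cf * etaS i) * ∑ μ : Fin (d + 1), DscoS i b B cfg U₁ (dirSliceK i μ ν A) (z, μ, c, c') := by
  rw [DvscoKH, coordOpKH_apply4, LinearMap.restrictScalars_apply, divY_apply_eq_sum_cdsS, Complex.coe_smul, map_smul, Finsupp.smul_apply, smul_eq_mul,
    map_sum, Finsupp.finsetSum_apply, Finset.mul_sum, Finset.mul_sum]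
  refine Finset.sum_congr rfl fun μ _ => ?_
  rw [DscoS, LinearMap.smul_apply, Pi.smul_apply, smul_eq_mul, coordOpK_apply4, LinearMap.restrictScalars_apply, cdsSL_apply, assembleK_dirSliceK,
    mul_assoc, mul_inv_cancel_left₀ (etaS_pos i).ne']

/-- ★★ the same inside the second (3.42) composite: `(GcoS T ∘ DvscoKH) A (z, ν, c, c′) = (c_f·η)·Σ_μ (GcoS T ∘ DscoS)(dirSliceK μ ν A)(z, μ, c, c′)`.
[cite: Balaban1985BackgroundPropagators, Thm 3.1 (3.43) ∕ (3.46) p.398 («G′(U)∇*_U»; the sup form (3.42) p.397 is the `∇_UG′(U)` side)] -/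
theorem GcoS_DvscoKH_apply_eq_sum (U₁ : B.Cfg) (A : XBK κ i → ℝ) (z : SiteY i) (ν : Fin (d + 1)) (c c' : κ) :
    (GcoS i b B cfg O U₁ ∘ₗ DvscoKH i b B cfg U₁) A (z, ν, c, c') =
      (i.cf * etaS i) * ∑ μ : Fin (d + 1), (GcoS i b B cfg O U₁ ∘ₗ DscoS i b B cfg U₁) (dirSliceK i μ ν A) (z, μ, c, c') := by
  have hη : etaS i ≠ 0 := (etaS_pos i).ne'
  -- the common site functions `G_μ := ∇*_{U,μ}((assembled ν-slice of A)_μ)`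
  set G : Fin (d + 1) → SiteY i → 𝔸 := fun μ => cdsS i (cfg U₁) μ (bondCompY i μ (assembleK b ν c' A)) with hG
  have key1 : assembleK b ν c' (DvscoKH i b B cfg U₁ A) = (i.cf : ℝ) • ∑ μ : Fin (d + 1), G μ := by
    rw [DvscoKH, assembleK_coordOpKH, LinearMap.restrictScalars_apply, divY_eq_sum_cdsSL_comp, LinearMap.smul_apply, Complex.coe_smul,
      LinearMap.coe_sum, Finset.sum_apply]
    rfl
  have key2 : ∀ μ : Fin (d + 1), assembleK b μ c' (DscoS i b B cfg U₁ (dirSliceK i μ ν A)) = (etaS i)⁻¹ • G μ := by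
    intro μ
    rw [DscoS, LinearMap.smul_apply, assembleK_smul, assembleK_coordOpK, LinearMap.restrictScalars_apply, cdsSL_apply, assembleK_dirSliceK]
  rw [LinearMap.comp_apply, GcoS, LinearMap.smul_apply, Pi.smul_apply, smul_eq_mul, coordOpK_apply4, key1, map_smul, map_sum, Pi.smul_apply,
    Finset.sum_apply, map_smul, map_sum, Finsupp.smul_apply, Finsupp.finsetSum_apply, smul_eq_mul, Finset.mul_sum, Finset.mul_sum, Finset.mul_sum]
  refine Finset.sum_congr rfl fun μ _ => ?_
  rw [LinearMap.comp_apply, LinearMap.smul_apply, Pi.smul_apply, smul_eq_mul, coordOpK_apply4, key2, map_smul, Pi.smul_apply, map_smul,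
    Finsupp.smul_apply, smul_eq_mul]
  have hX : ∀ X : ℝ, i.cf * etaS i * (etaS i ^ 2 * cR39 b * ((etaS i)⁻¹ * X)) = etaS i ^ 2 * cR39 b * (i.cf * X) := fun X => by
    calc i.cf * etaS i * (etaS i ^ 2 * cR39 b * ((etaS i)⁻¹ * X)) = i.cf * (etaS i ^ 2 * cR39 b) * (etaS i * ((etaS i)⁻¹ * X)) := by ring
      _ = etaS i ^ 2 * cR39 b * (i.cf * X) := by rw [mul_inv_cancel_left₀ hη]; ring
  exact (hX _).symm

/-- in print's units `c_f = L^k` (every `MemberY`, `MemberY.hcfk`; n06-i's `B9Ineq349SiteFromBlocks.etaS_eq_abs_cf_inv`) the bridge scalar is `1`.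
[cite: Balaban1984PropagatorsII, (2.1) p.224 («η = L^{−k}»)] -/
theorem cf_mul_etaS_of_hcfk (h : i.cf = (((ℓ + 1 : ℕ) : ℝ)) ^ i.k) : i.cf * etaS i = 1 := by
  have hk : nKT (toKT i) = (ℓ + 1) ^ i.k := rfl
  unfold etaS
  rw [hk, h]
  push_cast
  exact mul_inv_cancel₀ (pow_ne_zero _ (by positivity))

/-- the same for `|c_f|`. [cite: Balaban1984PropagatorsII, (2.1) p.224, bookkeeping] -/
theorem abs_cf_mul_etaS_of_hcfk (h : i.cf = (((ℓ + 1 : ℕ) : ℝ)) ^ i.k) : |i.cf| * etaS i = 1 := by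
  rw [abs_of_pos (by rw [h]; positivity), cf_mul_etaS_of_hcfk i h]

end Carriers

/-! ## §4 Majorant transfer across the bridge (generic geometry `g`, generic kernels): (3.42)-shaped `HasMajorantHom` statements -/

section Majorants

variable {κ : Type} {g : B6.Geometry}

omit [CompleteSpace 𝔸] in
/-- slot-copying preserves block support for a SLOT-BLIND site block map. [cite: Balaban1985BackgroundPropagators, (3.42) p.397 («supp λ ⊂ Δ(y′)»), bookkeeping] -/
theorem blockSupp_slotCopyK {blkS : XSK κ i → g.Site} (hS : ∀ (z : SiteY i) (μ ν : Fin (d + 1)) (a c : κ), blkS (z, μ, a, c) = blkS (z, ν, a, c))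
    {f : XSK κ i → ℝ} {y' : g.Site} {Bd : ℝ} (hf : BlockSupp blkS f y' Bd) (ν : Fin (d + 1)) : BlockSupp blkS (slotCopyK ν f) y' Bd where
  nonneg := hf.nonneg
  bound := by
    rintro ⟨z, μ, a, c⟩ hp
    exact hf.bound (z, ν, a, c) ((hS z ν μ a c).trans hp)
  off := by
    rintro ⟨z, μ, a, c⟩ hp
    exact hf.off (z, ν, a, c) fun h => hp ((hS z μ ν a c).trans h)

omit [CompleteSpace 𝔸] in
/-- direction-slicing preserves block support when the site block map reads, at `chart x`, the bond block map at the bonds leaving `x` (COMPATIBLE block maps).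
[cite: Balaban1985BackgroundPropagators, (3.42) p.397 («supp λ ⊂ Δ(y′)»), bookkeeping] -/
theorem blockSupp_dirSliceK {blkS : XSK κ i → g.Site} {blkB : XBK κ i → g.Site}
    (hSB : ∀ (x : Site (PV d ℓ i.m i.K hd hL) 0) (μ μ' ν : Fin (d + 1)) (a c : κ), blkS (chartY i x, μ', a, c) = blkB (⟨x, μ⟩, ν, a, c))
    {A : XBK κ i → ℝ} {y' : g.Site} {Bd : ℝ} (hA : BlockSupp blkB A y' Bd) (μ ν : Fin (d + 1)) : BlockSupp blkS (dirSliceK i μ ν A) y' Bd where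
  nonneg := hA.nonneg
  bound := by
    rintro ⟨w, μ', a, c⟩ hp
    have h := hSB ((chartY i).symm w) μ μ' ν a c
    rw [Equiv.apply_symm_apply] at h
    exact hA.bound _ (h.symm.trans hp)
  off := by
    rintro ⟨w, μ', a, c⟩ hp
    have h := hSB ((chartY i).symm w) μ μ' ν a c
    rw [Equiv.apply_symm_apply] at h
    exact hA.off _ fun h' => hp (h.trans h')

omit [CompleteSpace 𝔸] in
/-- compatible block maps have a slot-blind site part. [cite: Balaban1985BackgroundPropagators, (3.42) p.397, bookkeeping] -/
theorem slotBlind_of_compat {blkS : XSK κ i → g.Site} {blkB : XBK κ i → g.Site}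
    (hSB : ∀ (x : Site (PV d ℓ i.m i.K hd hL) 0) (μ μ' ν : Fin (d + 1)) (a c : κ), blkS (chartY i x, μ', a, c) = blkB (⟨x, μ⟩, ν, a, c))
    (z : SiteY i) (μ ν : Fin (d + 1)) (a c : κ) : blkS (z, μ, a, c) = blkS (z, ν, a, c) := by
  obtain ⟨x, rfl⟩ := (chartY i).surjective z
  rw [hSB x 0 μ 0 a c, hSB x 0 ν 0 a c]

/-- at n06-d's pins `blkS = blkSK (sIK bI)`, `blkB = blkBK bI`: the block maps are COMPATIBLE iff the fine-bond block map `bI` is blind to the direction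
(`bI⟨x, μ⟩ = bI⟨x, e₀⟩`, e.g. any `bI` factoring through NODE 00's `blkV1`, which reads `b₋` only). [cite: Balaban1984PropagatorsII, (2.45) p.231 + p.248 («sites replaced by bonds»), bookkeeping] -/
theorem compat_blkSK_blkBK {bI : FBondY i → IBondY i} (hbI : ∀ (x : Site (PV d ℓ i.m i.K hd hL) 0) (μ : Fin (d + 1)), bI ⟨x, μ⟩ = bI ⟨x, 0⟩)
    (x : Site (PV d ℓ i.m i.K hd hL) 0) (μ μ' ν : Fin (d + 1)) (a c : κ) :
    blkSK (κ := κ) i (sIK i bI) (chartY i x, μ', a, c) = blkBK (κ := κ) i bI (⟨x, μ⟩, ν, a, c) := by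
  show bI ⟨(chartY i).symm (chartY i x), 0⟩ = bI ⟨x, μ⟩
  rw [Equiv.symm_apply_apply]
  exact (hbI x μ).symm

variable [Fintype κ] (b : Module.Basis κ ℝ 𝔸) [FiniteDimensional ℝ 𝔸] (B : B9.Backgrounds) (cfg : B.Cfg → CfgY 𝔸 i) (O : SiteOpY 𝔸 i)

/-- ★★ **e1-TRANSFER**: a (3.42)-shaped majorant of n06-d's composite `DcoS ∘ GcoS T` (site carrier → site carrier, slot-blind block map) gives one of def-Y's
`DvcoKH ∘ GcoS T` (site carrier → bond carrier) under the kernel domination `(|c_f|η)·K(blkS(chart b₋, b.dir, ·), y′) ≤ K′(blkB(b, ν, ·), y′)`.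
[cite: Balaban1985BackgroundPropagators, Thm 3.1 (3.42) p.397 («|(∇_UG′(U)λ)(b)| ≤ …»)] -/
theorem hasMajorantHom_DvcoKH_GcoS {blkS : XSK κ i → g.Site} {blkB : XBK κ i → g.Site}
    (hS : ∀ (z : SiteY i) (μ ν : Fin (d + 1)) (a c : κ), blkS (z, μ, a, c) = blkS (z, ν, a, c)) (U₁ : B.Cfg) {K K' : g.Site → g.Site → ℝ}
    (h : HasMajorantHom blkS blkS (DcoS i b B cfg U₁ ∘ₗ GcoS i b B cfg O U₁) K)
    (hK : ∀ (x : FBondY i) (ν : Fin (d + 1)) (c c' : κ) (y' : g.Site), |i.cf| * etaS i * K (blkS (chartY i x.src, x.dir, c, c')) y' ≤ K' (blkB (x, ν, c, c')) y') :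
    HasMajorantHom blkS blkB (DvcoKH i b B cfg U₁ ∘ₗ GcoS i b B cfg O U₁) K' := by
  intro y' f Bd hf v
  obtain ⟨x, ν, c, c'⟩ := v
  rw [DvcoKH_GcoS_apply_eq, abs_mul, abs_mul, abs_of_pos (etaS_pos i)]
  have h1 := h y' (slotCopyK ν f) Bd (blockSupp_slotCopyK i hS hf ν) (chartY i x.src, x.dir, c, c')
  calc |i.cf| * etaS i * |(DcoS i b B cfg U₁ ∘ₗ GcoS i b B cfg O U₁) (slotCopyK ν f) (chartY i x.src, x.dir, c, c')|
      ≤ |i.cf| * etaS i * (K (blkS (chartY i x.src, x.dir, c, c')) y' * Bd) := mul_le_mul_of_nonneg_left h1 (mul_nonneg (abs_nonneg _) (etaS_pos i).le)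
    _ = |i.cf| * etaS i * K (blkS (chartY i x.src, x.dir, c, c')) y' * Bd := by ring
    _ ≤ K' (blkB (x, ν, c, c')) y' * Bd := mul_le_mul_of_nonneg_right (hK x ν c c' y') hf.nonneg

/-- ★★ e1-transfer for COMPATIBLE block maps (the bond block map reads the block of `b₋`): explicit kernel `(|c_f|η)·K`. [cite: Balaban1985BackgroundPropagators, Thm 3.1 (3.42) p.397] -/
theorem hasMajorantHom_DvcoKH_GcoS_of_compat {blkS : XSK κ i → g.Site} {blkB : XBK κ i → g.Site}
    (hSB : ∀ (x : Site (PV d ℓ i.m i.K hd hL) 0) (μ μ' ν : Fin (d + 1)) (a c : κ), blkS (chartY i x, μ', a, c) = blkB (⟨x, μ⟩, ν, a, c))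
    (U₁ : B.Cfg) {K : g.Site → g.Site → ℝ} (h : HasMajorantHom blkS blkS (DcoS i b B cfg U₁ ∘ₗ GcoS i b B cfg O U₁) K) :
    HasMajorantHom blkS blkB (DvcoKH i b B cfg U₁ ∘ₗ GcoS i b B cfg O U₁) (fun y y' => |i.cf| * etaS i * K y y') :=
  hasMajorantHom_DvcoKH_GcoS i b B cfg O (slotBlind_of_compat i hSB) U₁ h fun x ν c c' y' =>
    le_of_eq (congrArg (fun y => |i.cf| * etaS i * K y y') (hSB x.src x.dir x.dir ν c c'))

/-- ★★ **e2-TRANSFER** for compatible block maps: a majorant of `GcoS T ∘ DscoS` gives one of def-Y's `GcoS T ∘ DvscoKH` (bond carrier → site carrier), kernel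
`((d+1)|c_f|η)·K` (the direction sum costs the factor `d + 1`). [cite: Balaban1985BackgroundPropagators, Thm 3.1 (3.43) ∕ (3.46) p.398 («G′(U)∇*_U»)] -/
theorem hasMajorantHom_GcoS_DvscoKH_of_compat {blkS : XSK κ i → g.Site} {blkB : XBK κ i → g.Site}
    (hSB : ∀ (x : Site (PV d ℓ i.m i.K hd hL) 0) (μ μ' ν : Fin (d + 1)) (a c : κ), blkS (chartY i x, μ', a, c) = blkB (⟨x, μ⟩, ν, a, c))
    (U₁ : B.Cfg) {K : g.Site → g.Site → ℝ} (h : HasMajorantHom blkS blkS (GcoS i b B cfg O U₁ ∘ₗ DscoS i b B cfg U₁) K) :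
    HasMajorantHom blkB blkS (GcoS i b B cfg O U₁ ∘ₗ DvscoKH i b B cfg U₁) (fun y y' => ((d + 1 : ℕ) : ℝ) * (|i.cf| * etaS i) * K y y') := by
  intro y' A Bd hA v
  obtain ⟨z, ν, c, c'⟩ := v
  rw [GcoS_DvscoKH_apply_eq_sum, abs_mul, abs_mul, abs_of_pos (etaS_pos i)]
  have hterm : ∀ μ : Fin (d + 1), |(GcoS i b B cfg O U₁ ∘ₗ DscoS i b B cfg U₁) (dirSliceK i μ ν A) (z, μ, c, c')| ≤ K (blkS (z, ν, c, c')) y' * Bd := by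
    intro μ
    rw [← slotBlind_of_compat i hSB z μ ν c c']
    exact h y' _ Bd (blockSupp_dirSliceK i hSB hA μ ν) (z, μ, c, c')
  calc |i.cf| * etaS i * |∑ μ : Fin (d + 1), (GcoS i b B cfg O U₁ ∘ₗ DscoS i b B cfg U₁) (dirSliceK i μ ν A) (z, μ, c, c')|
      ≤ |i.cf| * etaS i * ∑ μ : Fin (d + 1), |(GcoS i b B cfg O U₁ ∘ₗ DscoS i b B cfg U₁) (dirSliceK i μ ν A) (z, μ, c, c')| :=
        mul_le_mul_of_nonneg_left (Finset.abs_sum_le_sum_abs _ _) (mul_nonneg (abs_nonneg _) (etaS_pos i).le)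
    _ ≤ |i.cf| * etaS i * ∑ _μ : Fin (d + 1), K (blkS (z, ν, c, c')) y' * Bd :=
        mul_le_mul_of_nonneg_left (Finset.sum_le_sum fun μ _ => hterm μ) (mul_nonneg (abs_nonneg _) (etaS_pos i).le)
    _ = ((d + 1 : ℕ) : ℝ) * (|i.cf| * etaS i) * K (blkS (z, ν, c, c')) y' * Bd := by
        rw [Finset.sum_const, Finset.card_univ, Fintype.card_fin, nsmul_eq_mul]; push_cast; ring

end Majorants

end Literature.MathematicalPhysics.QuantumFieldTheory.Balaban1983to89.Node00.OpsYNablaBridge
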